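import Summits.ResolutionOfSingularities.ResolutionOfSingularities.Theorems.FrobeniusLadderFInjectiveMacaulayficationFedderOrigin
import Summits.ResolutionOfSingularities.ResolutionOfSingularities.Theorems.FrobeniusLadderFInjectiveMacaulayficationBlowupFiModel
import Summits.ResolutionOfSingularities.ResolutionOfSingularities.Theorems.FrobeniusLadderFInjectiveMacaulayficationQuotLocalizationIso
import Summits.ResolutionOfSingularities.ResolutionOfSingularities.Theorems.FrobeniusLadderFInjectiveMacaulayficationDegreeZeroDescentLocal
import HarnessLib

/-!
# The threefold `X₀²X₁ + X₁²X₂ + X₂²X₀ + X₀X₃³ + X₁X₂X₃²` violates the clause at its origin (char. `2`)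

Support file for crux stmt-ResolutionOfSingularities-15315 (`FrobeniusLadder.FInjectiveMacaulayfication`,
line `Sketch`): stub `stub_threefoldOriginNotClause` of the THREEFOLD CALIBRATION (dimension `3`,
characteristic `2`).

Let `k` be a field of characteristic `2`, `S = k[X₀, X₁, X₂, X₃]`, `𝔪 = (X₀, X₁, X₂, X₃)` and
`f = X₀²X₁ + X₁²X₂ + X₂²X₀ + X₀X₃³ + X₁X₂X₃²`. Every monomial of `f` contains the square of a variable,
so `f = f^(2-1) ∈ (X₀², X₁², X₂², X₃²) = 𝔪^[2]` and Fedder's criterion at the origin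
(`Fedder.fedder_criterion_origin`) says that the hypersurface local ring `S_𝔪/(f)` does NOT satisfy the
per-stalk clause of the crux ("every system of parameters is weakly regular and generates a Frobenius
closed ideal"): the input of the threefold calibration is not F-injective at its origin, so its model
must be produced by a genuine modification. The statement is phrased for the local ring
`(S/(f))_{𝔪̄}` of the affine threefold at the image `𝔪̄` of `𝔪` (a maximal ideal); it is reached from
`S_𝔪/(f)` along the canonical isomorphism `S_𝔪/(f) ≅ (S/(f))_{𝔪̄}`
(`QuotLocalizationIso.stub_quotLocalizationIso`) by transport of the clause
(`DegreeZeroDescent.inlineClause_of_ringEquiv`) — exactly as for `E₈⁰` in characteristic `5`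
(`E8Char5FiModel.e8Char5_origin_not_clause`).

What is proved:

* `threefold_mem_frobeniusSpan` — `f ∈ (X₀², X₁², X₂², X₃²)` (explicit cofactors), over any
  commutative ring;
* `threefold_mem_span_range_X` — `f ∈ (X₀, X₁, X₂, X₃)`, over any commutative ring;
* `threefold_ne_zero` — `f ≠ 0` over a field (`f(1,1,0,0) = 1`);
* `threefold_origin_not_clause_local` — the local-ring form: `S_𝔪/(f)` violates the clause
  (`fedder_criterion_origin` with `threefold_mem_frobeniusSpan`);
* `threefold_origin_not_clause` / `stub_threefoldOriginNotClause` (registered form) — the affine form: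
  `(S/(f))_{𝔪̄}` violates the clause.

References: R. Fedder, *F-purity and rational singularity*, Trans. AMS 278 (1983), Prop. 1.7 and
Thm. 1.12 [Fedder1983] (through the imported criterion). The computation itself is folklore.
-/

-- single-problem summit: the doubled namespace component is forced
set_option linter.dupNamespace false

namespace Summit.ResolutionOfSingularities.ResolutionOfSingularities.Theorems.FInjectiveMacaulayfication.ThreefoldOriginNotClause

open MvPolynomial
open Summit.ResolutionOfSingularities.ResolutionOfSingularities.Theorems.FInjectiveMacaulayfication

section Poly

variable (k : Type) [CommRing k]

/-- **The threefold germ fails Fedder's test at `p = 2`:** every monomial of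
`f = X₀²X₁ + X₁²X₂ + X₂²X₀ + X₀X₃³ + X₁X₂X₃²` is a multiple of the square of a variable, so
`f ∈ (X₀², X₁², X₂², X₃²)`; explicit cofactors `f = X₁·X₀² + X₂·X₁² + X₀·X₂² + (X₀X₃ + X₁X₂)·X₃²`.
[cite: Fedder1983, Prop. 1.7] -/
theorem threefold_mem_frobeniusSpan :
    (X 0 ^ 2 * X 1 + X 1 ^ 2 * X 2 + X 2 ^ 2 * X 0 + X 0 * X 3 ^ 3 + X 1 * X 2 * X 3 ^ 2 :
        MvPolynomial (Fin 4) k) ∈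
      Ideal.span (Set.range fun i : Fin 4 => (X i : MvPolynomial (Fin 4) k) ^ 2) := by
  have hX : ∀ i : Fin 4, (X i : MvPolynomial (Fin 4) k) ^ 2 ∈
      Ideal.span (Set.range fun i : Fin 4 => (X i : MvPolynomial (Fin 4) k) ^ 2) :=
    fun i => Ideal.subset_span ⟨i, rfl⟩
  have h : (X 0 ^ 2 * X 1 + X 1 ^ 2 * X 2 + X 2 ^ 2 * X 0 + X 0 * X 3 ^ 3 + X 1 * X 2 * X 3 ^ 2 :
        MvPolynomial (Fin 4) k) =
      X 1 * X 0 ^ 2 + X 2 * X 1 ^ 2 + X 0 * X 2 ^ 2 + (X 0 * X 3 + X 1 * X 2) * X 3 ^ 2 := by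
    ring
  rw [h]
  exact add_mem (add_mem (add_mem (Ideal.mul_mem_left _ _ (hX 0)) (Ideal.mul_mem_left _ _ (hX 1)))
    (Ideal.mul_mem_left _ _ (hX 2))) (Ideal.mul_mem_left _ _ (hX 3))

/-- The threefold germ `f = X₀²X₁ + X₁²X₂ + X₂²X₀ + X₀X₃³ + X₁X₂X₃²` lies in the ideal
`(X₀, X₁, X₂, X₃)` of the origin (it has no constant term). [folklore] -/
theorem threefold_mem_span_range_X :
    (X 0 ^ 2 * X 1 + X 1 ^ 2 * X 2 + X 2 ^ 2 * X 0 + X 0 * X 3 ^ 3 + X 1 * X 2 * X 3 ^ 2 :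
        MvPolynomial (Fin 4) k) ∈
      Ideal.span (Set.range (X : Fin 4 → MvPolynomial (Fin 4) k)) := by
  have hX : ∀ i : Fin 4, (X i : MvPolynomial (Fin 4) k) ∈
      Ideal.span (Set.range (X : Fin 4 → MvPolynomial (Fin 4) k)) :=
    fun i => Ideal.subset_span ⟨i, rfl⟩
  exact add_mem (add_mem (add_mem (add_mem (Ideal.mul_mem_left _ _ (hX 1))
    (Ideal.mul_mem_left _ _ (hX 2))) (Ideal.mul_mem_left _ _ (hX 0)))
    (Ideal.mul_mem_left _ _ (Ideal.pow_mem_of_mem _ (hX 3) 3 (by norm_num))))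
    (Ideal.mul_mem_left _ _ (Ideal.pow_mem_of_mem _ (hX 3) 2 (by norm_num)))

end Poly

section FieldCase

variable (k : Type) [Field k]

/-- The threefold germ `f = X₀²X₁ + X₁²X₂ + X₂²X₀ + X₀X₃³ + X₁X₂X₃²` is non-zero over a field:
`f(1, 1, 0, 0) = 1`. [folklore] -/
theorem threefold_ne_zero :
    (X 0 ^ 2 * X 1 + X 1 ^ 2 * X 2 + X 2 ^ 2 * X 0 + X 0 * X 3 ^ 3 + X 1 * X 2 * X 3 ^ 2 :
        MvPolynomial (Fin 4) k) ≠ 0 := by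
  intro h0
  have h1 := congrArg
    (MvPolynomial.eval (fun j : Fin 4 => if j = 0 ∨ j = 1 then (1 : k) else 0)) h0
  simp only [map_add, map_mul, map_pow, MvPolynomial.eval_X, Fin.isValue, Fin.reduceEq,
    or_true, or_false, ↓reduceIte, map_zero] at h1
  norm_num at h1

variable [CharP k 2]

/-- **The threefold germ at the origin violates the crux's clause in characteristic `2`** (local-ring
level): for `S = k[X₀, X₁, X₂, X₃]`, `P = (X₀, X₁, X₂, X₃)`, the hypersurface local ring `S_P/(f)`,
`f = X₀²X₁ + X₁²X₂ + X₂²X₀ + X₀X₃³ + X₁X₂X₃²`, does NOT satisfy "all s.o.p. weakly regular and all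
parameter ideals Frobenius closed" — `f^(2-1) = f ∈ (X₀², X₁², X₂², X₃²)`, so Fedder's criterion
(`Fedder.fedder_criterion_origin` with `threefold_mem_frobeniusSpan`) fails. [cite: Fedder1983, Thm. 1.12] -/
theorem threefold_origin_not_clause_local (P : Ideal (MvPolynomial (Fin 4) k)) [P.IsMaximal]
    (hP : P = Ideal.span (Set.range (MvPolynomial.X : Fin 4 → MvPolynomial (Fin 4) k)))
    (f : MvPolynomial (Fin 4) k)
    (hf : f = MvPolynomial.X 0 ^ 2 * MvPolynomial.X 1 + MvPolynomial.X 1 ^ 2 * MvPolynomial.X 2 +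
      MvPolynomial.X 2 ^ 2 * MvPolynomial.X 0 + MvPolynomial.X 0 * MvPolynomial.X 3 ^ 3 +
      MvPolynomial.X 1 * MvPolynomial.X 2 * MvPolynomial.X 3 ^ 2) :
    ¬ (∀ d : ℕ, ringKrullDim (Localization.AtPrime P ⧸ Ideal.span {algebraMap (MvPolynomial (Fin 4) k)
        (Localization.AtPrime P) f}) = d →
      ∀ s : Fin d → Localization.AtPrime P ⧸ Ideal.span {algebraMap (MvPolynomial (Fin 4) k)
          (Localization.AtPrime P) f},
        Ideal.IsMaximal (Ideal.radical (Ideal.span (Set.range s))) →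
          RingTheory.Sequence.IsWeaklyRegular (Localization.AtPrime P ⧸ Ideal.span
              {algebraMap (MvPolynomial (Fin 4) k) (Localization.AtPrime P) f}) (List.ofFn s) ∧
          ∀ y : Localization.AtPrime P ⧸ Ideal.span {algebraMap (MvPolynomial (Fin 4) k)
              (Localization.AtPrime P) f},
            (∃ e : ℕ, y ^ 2 ^ e ∈ Ideal.span ((fun z : Localization.AtPrime P ⧸ Ideal.span
                {algebraMap (MvPolynomial (Fin 4) k) (Localization.AtPrime P) f} => z ^ 2 ^ e) ''
                  (Ideal.span (Set.range s) : Set (Localization.AtPrime P ⧸ Ideal.span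
                    {algebraMap (MvPolynomial (Fin 4) k) (Localization.AtPrime P) f})))) →
              y ∈ Ideal.span (Set.range s)) := by
  haveI : Fact (Nat.Prime 2) := ⟨Nat.prime_two⟩
  have hfP : f ∈ P := by
    rw [hP, hf]
    exact threefold_mem_span_range_X k
  have hf0 : f ≠ 0 := by
    rw [hf]
    exact threefold_ne_zero k
  rw [Fedder.fedder_criterion_origin 2 k 4 P hP f hfP hf0, not_not, hf,
    show (2 : ℕ) - 1 = 1 from rfl, pow_one]
  exact threefold_mem_frobeniusSpan k

/-- **The input of the threefold calibration is NOT its own model**: in characteristic `2` the affine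
threefold `k[X₀, X₁, X₂, X₃]/(f)`, `f = X₀²X₁ + X₁²X₂ + X₂²X₀ + X₀X₃³ + X₁X₂X₃²`, violates the clause at
its local ring at the origin `𝔪̄` (the image of `(X₀, X₁, X₂, X₃)`, a maximal ideal):
`threefold_origin_not_clause_local` (Fedder's criterion), transported from `k[X]_{(X)}/(f)` to
`(k[X]/(f))_{𝔪̄}` along `QuotLocalizationIso.stub_quotLocalizationIso` by
`DegreeZeroDescent.inlineClause_of_ringEquiv`. [cite: Fedder1983, Thm. 1.12] -/
theorem threefold_origin_not_clause (f : MvPolynomial (Fin 4) k)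
    (hf : f = MvPolynomial.X 0 ^ 2 * MvPolynomial.X 1 + MvPolynomial.X 1 ^ 2 * MvPolynomial.X 2 +
      MvPolynomial.X 2 ^ 2 * MvPolynomial.X 0 + MvPolynomial.X 0 * MvPolynomial.X 3 ^ 3 +
      MvPolynomial.X 1 * MvPolynomial.X 2 * MvPolynomial.X 3 ^ 2) :
    ∃ (P : Ideal (MvPolynomial (Fin 4) k ⧸ Ideal.span {f})) (_ : P.IsMaximal),
      ¬ (∀ d : ℕ, ringKrullDim (Localization.AtPrime P) = d → ∀ s : Fin d → Localization.AtPrime P,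
        (Ideal.span (Set.range s)).radical.IsMaximal →
          RingTheory.Sequence.IsWeaklyRegular (Localization.AtPrime P) (List.ofFn s) ∧
          ∀ y : Localization.AtPrime P, (∃ e : ℕ, y ^ 2 ^ e ∈ Ideal.span
            ((fun z : Localization.AtPrime P => z ^ 2 ^ e) ''
              (Ideal.span (Set.range s) : Set (Localization.AtPrime P)))) → y ∈ Ideal.span (Set.range s)) := by
  haveI hmax : (Ideal.span (Set.range (MvPolynomial.X : Fin 4 → MvPolynomial (Fin 4) k))).IsMaximal :=
    Fedder.isMaximal_span_range_X k 4
  have hfm : f ∈ Ideal.span (Set.range (MvPolynomial.X : Fin 4 → MvPolynomial (Fin 4) k)) := by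
    rw [hf]
    exact threefold_mem_span_range_X k
  have hker : RingHom.ker (Ideal.Quotient.mk (Ideal.span {f})) ≤
      Ideal.span (Set.range (MvPolynomial.X : Fin 4 → MvPolynomial (Fin 4) k)) := by
    rw [Ideal.mk_ker, Ideal.span_singleton_le_iff_mem]
    exact hfm
  obtain ⟨hPmax, hcomap⟩ := BlowupFiModel.isMaximal_map_and_comap_map_of_surjective
    (Ideal.Quotient.mk (Ideal.span {f})) Ideal.Quotient.mk_surjective
    (Ideal.span (Set.range (MvPolynomial.X : Fin 4 → MvPolynomial (Fin 4) k))) hker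
  haveI := hPmax
  refine ⟨_, hPmax, fun hclause => ?_⟩
  obtain ⟨e⟩ := QuotLocalizationIso.stub_quotLocalizationIso (MvPolynomial (Fin 4) k) f
    (Ideal.span (Set.range (MvPolynomial.X : Fin 4 → MvPolynomial (Fin 4) k))) _ hcomap
  have key := DegreeZeroDescent.inlineClause_of_ringEquiv 2 e.symm hclause
  exact threefold_origin_not_clause_local k _ rfl f hf key

end FieldCase

/-- **THREEFOLD CALIBRATION — the input fails the clause at the origin, registered form** (stub
`stub_threefoldOriginNotClause` of crux stmt-ResolutionOfSingularities-15315, line `Sketch`): for every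
field `k` of characteristic `2` and `f = X₀²X₁ + X₁²X₂ + X₂²X₀ + X₀X₃³ + X₁X₂X₃²`, the local ring of
`k[X₀, X₁, X₂, X₃]/(f)` at (the image of) the origin does not satisfy "every system of parameters is
weakly regular and generates a Frobenius closed ideal" — `= threefold_origin_not_clause`.
[cite: Fedder1983, Thm. 1.12] -/
theorem stub_threefoldOriginNotClause : ∀ (k : Type) [Field k] [CharP k 2] (f : MvPolynomial (Fin 4) k),
    f = MvPolynomial.X 0 ^ 2 * MvPolynomial.X 1 + MvPolynomial.X 1 ^ 2 * MvPolynomial.X 2 + MvPolynomial.X 2 ^ 2 * MvPolynomial.X 0 + MvPolynomial.X 0 * MvPolynomial.X 3 ^ 3 + MvPolynomial.X 1 * MvPolynomial.X 2 * MvPolynomial.X 3 ^ 2 →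
    ∃ (P : Ideal (MvPolynomial (Fin 4) k ⧸ Ideal.span {f})) (_ : P.IsMaximal),
      ¬ (∀ d : ℕ, ringKrullDim (Localization.AtPrime P) = d → ∀ s : Fin d → Localization.AtPrime P,
        (Ideal.span (Set.range s)).radical.IsMaximal →
          RingTheory.Sequence.IsWeaklyRegular (Localization.AtPrime P) (List.ofFn s) ∧
          ∀ y : Localization.AtPrime P, (∃ e : ℕ, y ^ 2 ^ e ∈ Ideal.span
            ((fun z : Localization.AtPrime P => z ^ 2 ^ e) ''
              (Ideal.span (Set.range s) : Set (Localization.AtPrime P)))) → y ∈ Ideal.span (Set.range s)) :=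
  fun k _ _ f hf => threefold_origin_not_clause k f hf

end Summit.ResolutionOfSingularities.ResolutionOfSingularities.Theorems.FInjectiveMacaulayfication.ThreefoldOriginNotClause
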